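import Summits.QuantumFields.YangMills.Theorems.ColdStartUniversalityLatticeLangevinWilsonSemigroupLogSobolev
import Summits.QuantumFields.YangMills.Theorems.ColdStartUniversalityLatticeLangevinCylinderDynkinBound
import Summits.QuantumFields.YangMills.Theorems.ColdStartUniversalityLatticeLangevinWilsonEntropyProduction
import HarnessLib

/-!
# Route `ColdStartUniversality` (fixed-cut-off package, entropy side): ★★ LOG-SOBOLEV ⇒ EXPONENTIAL DECAY OF ENTROPY along the
# SZZ semigroup at EVERY `(L, β')` — Bakry–Gentil–Ledoux Thm 5.2.1 (i)⇒(ii), no core / smoothing / hypercontractivity input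

Helper file (seat `ym-line-csu-p1`, g21; `--supports stmt-QuantumFields-27363`).  SU(2) SZZ dynamics at `(L, β')`, reversible w.r.t.
`μ = μ_{β'}`, ANY realising kernel family `κ`: the generator-form log-Sobolev inequality `ρ Ent_μ(F²) ≤ −∫ F·𝓛f dμ` on `C³` cylinders
implies `Ent_μ(κ_t F) ≤ e^{−4ρt} Ent_μ(F)` for every POSITIVE `C³` compactly supported cylinder `F` (`Ent_μ(w) = ∫ w log w dμ −
(∫ w) log ∫ w`, `κ_t F(x) = E F(U^x_t)`; by reversibility `κ_t F·μ` is the law at time `t` from the law `F·μ`).  Route: `φ(t) =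
Ent_μ(κ_t F)` is continuous (tube lemma); `κ_h(κ_t F) = κ_{t+h}F`; Dynkin `|κ_{t+h}F − κ_tF| ≤ h·sup|𝓛F|`; the scale-`h` entropy
production inequality; the semigroup-form log-Sobolev inequality at `√κ_tF` and `𝓔_h ↑` as `h ↓`: `limsup_{h↓0}(φ(t+h) − φ(t))/h
≤ −4ρφ(t)`; fencing (`EntropyFlow.le_mul_exp_neg_mul_of_slope`).
* `entropy_transition_sub_lt_of_generatorLogSobolev` — the infinitesimal step; ★★ `entropy_transition_le_exp_of_generatorLogSobolev`.
THEOREMS ONLY, no definition, no sorry.  HONEST FRAMING: RECORD-rung R3 plumbing at FIXED cut-off; the log-Sobolev inequality is the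
HYPOTHESIS (K-uniformly in physical units it is the open input of LINE 4 «cold_entropy»); nothing K-uniform is proved; no crux, rung
or summit statement is proved; the Yang–Mills mass gap is NOT proved.
-/

set_option autoImplicit false

noncomputable section

namespace Summit.QuantumFields.YangMills.Theorems.ColdStartUniversality

open MeasureTheory ProbabilityTheory Filter Set Topology
open scoped BigOperators NNReal ENNReal
open Literature.Probability.Process Literature.MathematicalPhysics.QuantumFieldTheory
open Literature.MathematicalPhysics.QuantumLattice (fundamentalRep fundamentalLatticeRep continuous_fundamentalRep)

variable {L : ℕ} [NeZero L]

/-! ## Log-Sobolev ⇒ exponential decay of entropy along the semigroup -/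

/-- **The infinitesimal step.**  Under the generator-form log-Sobolev inequality with constant `ρ`, let `v` be continuous with
`δ ≤ v` (`δ > 0`) and `|κ_h v − v| ≤ C h` for all `h`.  Then for every `r > −4ρ Ent_μ(v)` there is `h* > 0` with
`Ent_μ(κ_h v) − Ent_μ(v) < r·h` for all `0 < h < h*`: the scale-`h` entropy production inequality, the semigroup-form log-Sobolev
inequality at `√v` (`semigroupLogSobolev_of_generatorLogSobolev`) and `𝓔_h ↑` as `h ↓` (`dirichletScale_antitone`).
[cite: BakryGentilLedoux2014, Thm 5.2.1 (proof)] -/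
theorem entropy_transition_sub_lt_of_generatorLogSobolev (L : ℕ) [NeZero L] (β' : ℝ)
    (κ : ℝ≥0 → Kernel (GaugeConfig 3 L (Matrix.specialUnitaryGroup (Fin 2) ℂ))
      (GaugeConfig 3 L (Matrix.specialUnitaryGroup (Fin 2) ℂ))) [∀ t, IsMarkovKernel (κ t)]
    (hreal : ∀ (t : ℝ≥0) (x : GaugeConfig 3 L (Matrix.specialUnitaryGroup (Fin 2) ℂ))
        (Ω : Type) [MeasurableSpace Ω] (P : Measure Ω) [IsProbabilityMeasure P]
        (W : ℝ≥0 → Ω → (Edge 3 L × NoiseIdx 2 → ℝ)) (hW : IsFlatBrownian W P)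
        (U : ℝ≥0 → Ω → GaugeConfig 3 L (Matrix.specialUnitaryGroup (Fin 2) ℂ)),
        (∀ ω, U 0 ω = x) →
        (latticeLangevinDynamics (fundamentalLatticeRep 2) β').IsSolution (fundamentalRep (Fin 2))
          hW.natFiltration P W U →
        κ t x = P.map (U t))
    {ρ : ℝ}
    (hLSgen : ∀ (f : (Edge 3 L × Fin 2 × Fin 2 × Bool → ℝ) → ℝ), ContDiff ℝ 3 f →
        let coords : GaugeConfig 3 L (Matrix.specialUnitaryGroup (Fin 2) ℂ) → (Edge 3 L × Fin 2 × Fin 2 × Bool → ℝ) :=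
          fun V q => (fun z : ℂ => if q.2.2.2 then z.im else z.re)
            ((fundamentalRep (Fin 2) (V q.1) : Matrix (Fin 2) (Fin 2) ℂ) q.2.1 q.2.2.1)
        let gen : GaugeConfig 3 L (Matrix.specialUnitaryGroup (Fin 2) ℂ) → ℝ := fun V =>
          (∑ i : Edge 3 L × Fin 2 × Fin 2 × Bool, fderiv ℝ f (coords V) (Pi.single i 1) *
              (fun z : ℂ => if i.2.2.2 then z.im else z.re)
                ((latticeLangevinDynamics (fundamentalLatticeRep 2) β').drift
                  (matrixConfig (fundamentalRep (Fin 2)) V) i.1 i.2.1 i.2.2.1) +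
          1 / 2 * ∑ i : Edge 3 L × Fin 2 × Fin 2 × Bool, ∑ j : Edge 3 L × Fin 2 × Fin 2 × Bool,
            fderiv ℝ (fun z => fderiv ℝ f z (Pi.single i 1)) (coords V) (Pi.single j 1) *
              ∑ n : Edge 3 L × NoiseIdx 2,
                (if n.1 = i.1 then (fun z : ℂ => if i.2.2.2 then z.im else z.re)
                  ((latticeLangevinDynamics (fundamentalLatticeRep 2) β').noise
                    (matrixConfig (fundamentalRep (Fin 2)) V) i.1 n.2 i.2.1 i.2.2.1) else 0) *
                (if n.1 = j.1 then (fun z : ℂ => if j.2.2.2 then z.im else z.re)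
                  ((latticeLangevinDynamics (fundamentalLatticeRep 2) β').noise
                    (matrixConfig (fundamentalRep (Fin 2)) V) j.1 n.2 j.2.1 j.2.2.1) else 0))
        ρ * ((∫ V, f (coords V) ^ 2 * Real.log (f (coords V) ^ 2) ∂(wilsonMeasure (d := 3) (L := L) (fundamentalRep (Fin 2)) β')) -
            (∫ V, f (coords V) ^ 2 ∂(wilsonMeasure (d := 3) (L := L) (fundamentalRep (Fin 2)) β')) *
              Real.log (∫ V, f (coords V) ^ 2 ∂(wilsonMeasure (d := 3) (L := L) (fundamentalRep (Fin 2)) β'))) ≤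
          -∫ V, f (coords V) * gen V ∂(wilsonMeasure (d := 3) (L := L) (fundamentalRep (Fin 2)) β'))
    {v : GaugeConfig 3 L (Matrix.specialUnitaryGroup (Fin 2) ℂ) → ℝ} (hvc : Continuous v) {δ : ℝ} (hδ : 0 < δ)
    (hvδ : ∀ x, δ ≤ v x) {C : ℝ} (hC : ∀ (h : ℝ≥0) (x : GaugeConfig 3 L (Matrix.specialUnitaryGroup (Fin 2) ℂ)),
      |(∫ y, v y ∂(κ h x)) - v x| ≤ C * h)
    {r : ℝ} (hr : -(4 * ρ) * ((∫ x, v x * Real.log (v x) ∂(wilsonMeasure (d := 3) (L := L) (fundamentalRep (Fin 2)) β')) -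
      (∫ x, v x ∂(wilsonMeasure (d := 3) (L := L) (fundamentalRep (Fin 2)) β')) *
        Real.log (∫ x, v x ∂(wilsonMeasure (d := 3) (L := L) (fundamentalRep (Fin 2)) β'))) < r) :
    ∃ hstar : ℝ, 0 < hstar ∧ ∀ h : ℝ≥0, 0 < h → (h : ℝ) < hstar →
      ((∫ x, (∫ y, v y ∂(κ h x)) * Real.log (∫ y, v y ∂(κ h x)) ∂(wilsonMeasure (d := 3) (L := L) (fundamentalRep (Fin 2)) β')) -
        (∫ x, (∫ y, v y ∂(κ h x)) ∂(wilsonMeasure (d := 3) (L := L) (fundamentalRep (Fin 2)) β')) *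
          Real.log (∫ x, (∫ y, v y ∂(κ h x)) ∂(wilsonMeasure (d := 3) (L := L) (fundamentalRep (Fin 2)) β'))) -
      ((∫ x, v x * Real.log (v x) ∂(wilsonMeasure (d := 3) (L := L) (fundamentalRep (Fin 2)) β')) -
        (∫ x, v x ∂(wilsonMeasure (d := 3) (L := L) (fundamentalRep (Fin 2)) β')) *
          Real.log (∫ x, v x ∂(wilsonMeasure (d := 3) (L := L) (fundamentalRep (Fin 2)) β'))) < r * h := by
  classical
  haveI := secondCountableTopology_su2
  haveI := borelSpace_config L
  set μ : Measure (GaugeConfig 3 L (Matrix.specialUnitaryGroup (Fin 2) ℂ)) :=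
    wilsonMeasure (d := 3) (L := L) (fundamentalRep (Fin 2)) β' with hμ
  haveI : IsProbabilityMeasure μ :=
    isProbabilityMeasure_wilsonMeasure (d := 3) (L := L) (fundamentalRep (Fin 2)) (continuous_fundamentalRep (Fin 2)) β'
  set Ev : ℝ := (∫ x, v x * Real.log (v x) ∂μ) - (∫ x, v x ∂μ) * Real.log (∫ x, v x ∂μ) with hEv
  have hvpos : ∀ x, 0 < v x := fun x => lt_of_lt_of_le hδ (hvδ x)
  have hC0 : 0 ≤ C := by
    have h1 := hC 1 (Classical.arbitrary _)
    have : (0 : ℝ) ≤ C * ((1 : ℝ≥0) : ℝ) := (abs_nonneg _).trans h1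
    simpa using this
  have hvlog : Continuous fun x => v x * Real.log (v x) := hvc.mul (hvc.log fun x => (hvpos x).ne')
  have hEv0 : 0 ≤ Ev := entropy_nonneg μ (fun x => (hvpos x).le) (integrable_of_continuous_of_compactSpace hvc _)
    (integrable_of_continuous_of_compactSpace hvlog _)
  have hgap : 0 < r + 4 * ρ * Ev := by linarith
  -- the semigroup log-Sobolev inequality at `√v` with a small `η`
  set η : ℝ := (r + 4 * ρ * Ev) / (8 * (Ev + 1)) with hη
  have hηpos : 0 < η := by positivity
  have hsqc : Continuous fun x => Real.sqrt (v x) := Real.continuous_sqrt.comp hvc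
  obtain ⟨h₁, hh₁, hLS⟩ := semigroupLogSobolev_of_generatorLogSobolev L β' κ hreal hLSgen hsqc hηpos
  have esq : ∀ x, Real.sqrt (v x) ^ 2 = v x := fun x => Real.sq_sqrt (hvpos x).le
  simp only [esq] at hLS
  -- `hLS : (ρ − η) Ev ≤ 𝓔_{h₁}(√v)`
  have hηEv : 4 * η * Ev ≤ (r + 4 * ρ * Ev) / 2 := by
    have h1 : Ev / (Ev + 1) ≤ 1 := by rw [div_le_one (by linarith)]; linarith
    have e : 4 * η * Ev = (r + 4 * ρ * Ev) / 2 * (Ev / (Ev + 1)) := by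
      rw [hη]; field_simp; ring
    rw [e]
    calc (r + 4 * ρ * Ev) / 2 * (Ev / (Ev + 1)) ≤ (r + 4 * ρ * Ev) / 2 * 1 :=
          mul_le_mul_of_nonneg_left h1 (by linarith)
      _ = (r + 4 * ρ * Ev) / 2 := mul_one _
  refine ⟨min (h₁ : ℝ) ((r + 4 * ρ * Ev) * δ / (4 * (C ^ 2 + 1))), lt_min (by exact_mod_cast hh₁) (by positivity),
    fun h hh hhlt => ?_⟩
  have hhR : (0 : ℝ) < h := by exact_mod_cast hh
  have hhh₁ : h ≤ h₁ := by exact_mod_cast (hhlt.le.trans (min_le_left _ _))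
  have hh2 : (h : ℝ) ≤ (r + 4 * ρ * Ev) * δ / (4 * (C ^ 2 + 1)) := hhlt.le.trans (min_le_right _ _)
  -- scale-`h` entropy production with `D = C h`
  have hstep := entropy_transition_sub_entropy_le_dirichletScale L β' κ hreal h hvc hδ hvδ (fun x => hC h x)
  -- `𝓔_h(√v) ≥ 𝓔_{h₁}(√v) ≥ (ρ − η) Ev`
  have hanti := dirichletScale_antitone L β' κ hreal hh hhh₁ hsqc
  have hE : (ρ - η) * Ev * h ≤ (∫ x, Real.sqrt (v x) * Real.sqrt (v x) ∂μ) -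
      ∫ x, Real.sqrt (v x) * (∫ y, Real.sqrt (v y) ∂(κ h x)) ∂μ := by
    have h1 := hLS.trans hanti
    rwa [inv_mul_eq_div, le_div_iff₀ hhR] at h1
  -- `(C h)²/δ ≤ h (r + 4ρEv)/4`
  have hsq : (C * h) ^ 2 / δ ≤ h * ((r + 4 * ρ * Ev) / 4) := by
    rw [div_le_iff₀ hδ]
    have h3 : C ^ 2 * (h : ℝ) ≤ (C ^ 2 + 1) * ((r + 4 * ρ * Ev) * δ / (4 * (C ^ 2 + 1))) :=
      calc C ^ 2 * (h : ℝ) ≤ (C ^ 2 + 1) * h := by nlinarith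
        _ ≤ (C ^ 2 + 1) * ((r + 4 * ρ * Ev) * δ / (4 * (C ^ 2 + 1))) := mul_le_mul_of_nonneg_left hh2 (by positivity)
    have e : (C ^ 2 + 1) * ((r + 4 * ρ * Ev) * δ / (4 * (C ^ 2 + 1))) = (r + 4 * ρ * Ev) / 4 * δ := by
      field_simp
    rw [e] at h3
    calc (C * h) ^ 2 = (C ^ 2 * h) * h := by ring
      _ ≤ ((r + 4 * ρ * Ev) / 4 * δ) * h := mul_le_mul_of_nonneg_right h3 hhR.le
      _ = h * ((r + 4 * ρ * Ev) / 4) * δ := by ring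
  have hfin : -4 * ((ρ - η) * Ev * h) + h * ((r + 4 * ρ * Ev) / 4) < r * h := by
    have e : -4 * ((ρ - η) * Ev * h) + h * ((r + 4 * ρ * Ev) / 4) =
        h * (-(4 * ρ * Ev) + 4 * η * Ev + (r + 4 * ρ * Ev) / 4) := by ring
    rw [e, mul_comm r (h : ℝ)]
    refine mul_lt_mul_of_pos_left ?_ hhR
    nlinarith [hηEv, hgap]
  refine lt_of_le_of_lt hstep ?_
  linarith [hE, hsq, hfin]


/-- ★★ **Log-Sobolev ⇒ exponential decay of entropy, UNCONDITIONALLY** (BGL Thm 5.2.1 (i)⇒(ii) for the SU(2) SZZ dynamics at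
every fixed cut-off).  If `ρ Ent_μ(F²) ≤ −∫ F·𝓛f dμ_{β'}` for every `C³` `f` (`F = f∘coords`), `ρ > 0`, then for every `C³`
compactly supported `f` with `F = f∘coords > 0` on `SU(2)^E`, every realising kernel family and every `t ≥ 0`,

  `Ent_μ(κ_t F) ≤ e^{−4ρt} · Ent_μ(F)`,   `Ent_μ(w) = ∫ w log w dμ − (∫ w dμ) log(∫ w dμ)`.

[cite: BakryGentilLedoux2014, Thm 5.2.1] -/
theorem entropy_transition_le_exp_of_generatorLogSobolev (L : ℕ) [NeZero L] (β' : ℝ)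
    (κ : ℝ≥0 → Kernel (GaugeConfig 3 L (Matrix.specialUnitaryGroup (Fin 2) ℂ))
      (GaugeConfig 3 L (Matrix.specialUnitaryGroup (Fin 2) ℂ))) [∀ t, IsMarkovKernel (κ t)]
    (hreal : ∀ (t : ℝ≥0) (x : GaugeConfig 3 L (Matrix.specialUnitaryGroup (Fin 2) ℂ))
        (Ω : Type) [MeasurableSpace Ω] (P : Measure Ω) [IsProbabilityMeasure P]
        (W : ℝ≥0 → Ω → (Edge 3 L × NoiseIdx 2 → ℝ)) (hW : IsFlatBrownian W P)
        (U : ℝ≥0 → Ω → GaugeConfig 3 L (Matrix.specialUnitaryGroup (Fin 2) ℂ)),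
        (∀ ω, U 0 ω = x) →
        (latticeLangevinDynamics (fundamentalLatticeRep 2) β').IsSolution (fundamentalRep (Fin 2))
          hW.natFiltration P W U →
        κ t x = P.map (U t))
    {ρ : ℝ} (hρ : 0 < ρ)
    (hLSgen : ∀ (f : (Edge 3 L × Fin 2 × Fin 2 × Bool → ℝ) → ℝ), ContDiff ℝ 3 f →
        let coords : GaugeConfig 3 L (Matrix.specialUnitaryGroup (Fin 2) ℂ) → (Edge 3 L × Fin 2 × Fin 2 × Bool → ℝ) :=
          fun V q => (fun z : ℂ => if q.2.2.2 then z.im else z.re)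
            ((fundamentalRep (Fin 2) (V q.1) : Matrix (Fin 2) (Fin 2) ℂ) q.2.1 q.2.2.1)
        let gen : GaugeConfig 3 L (Matrix.specialUnitaryGroup (Fin 2) ℂ) → ℝ := fun V =>
          (∑ i : Edge 3 L × Fin 2 × Fin 2 × Bool, fderiv ℝ f (coords V) (Pi.single i 1) *
              (fun z : ℂ => if i.2.2.2 then z.im else z.re)
                ((latticeLangevinDynamics (fundamentalLatticeRep 2) β').drift
                  (matrixConfig (fundamentalRep (Fin 2)) V) i.1 i.2.1 i.2.2.1) +
          1 / 2 * ∑ i : Edge 3 L × Fin 2 × Fin 2 × Bool, ∑ j : Edge 3 L × Fin 2 × Fin 2 × Bool,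
            fderiv ℝ (fun z => fderiv ℝ f z (Pi.single i 1)) (coords V) (Pi.single j 1) *
              ∑ n : Edge 3 L × NoiseIdx 2,
                (if n.1 = i.1 then (fun z : ℂ => if i.2.2.2 then z.im else z.re)
                  ((latticeLangevinDynamics (fundamentalLatticeRep 2) β').noise
                    (matrixConfig (fundamentalRep (Fin 2)) V) i.1 n.2 i.2.1 i.2.2.1) else 0) *
                (if n.1 = j.1 then (fun z : ℂ => if j.2.2.2 then z.im else z.re)
                  ((latticeLangevinDynamics (fundamentalLatticeRep 2) β').noise
                    (matrixConfig (fundamentalRep (Fin 2)) V) j.1 n.2 j.2.1 j.2.2.1) else 0))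
        ρ * ((∫ V, f (coords V) ^ 2 * Real.log (f (coords V) ^ 2) ∂(wilsonMeasure (d := 3) (L := L) (fundamentalRep (Fin 2)) β')) -
            (∫ V, f (coords V) ^ 2 ∂(wilsonMeasure (d := 3) (L := L) (fundamentalRep (Fin 2)) β')) *
              Real.log (∫ V, f (coords V) ^ 2 ∂(wilsonMeasure (d := 3) (L := L) (fundamentalRep (Fin 2)) β'))) ≤
          -∫ V, f (coords V) * gen V ∂(wilsonMeasure (d := 3) (L := L) (fundamentalRep (Fin 2)) β'))
    {f : (Edge 3 L × Fin 2 × Fin 2 × Bool → ℝ) → ℝ} (hf : ContDiff ℝ 3 f) (hfc : HasCompactSupport f)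
    (hpos : ∀ x : GaugeConfig 3 L (Matrix.specialUnitaryGroup (Fin 2) ℂ),
      0 < f (fun q => (fun z : ℂ => if q.2.2.2 then z.im else z.re)
        ((fundamentalRep (Fin 2) (x q.1) : Matrix (Fin 2) (Fin 2) ℂ) q.2.1 q.2.2.1)))
    (t : ℝ≥0) :
    let F : GaugeConfig 3 L (Matrix.specialUnitaryGroup (Fin 2) ℂ) → ℝ := fun x =>
      f (fun q => (fun z : ℂ => if q.2.2.2 then z.im else z.re)
        ((fundamentalRep (Fin 2) (x q.1) : Matrix (Fin 2) (Fin 2) ℂ) q.2.1 q.2.2.1))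
    (∫ x, (∫ y, F y ∂(κ t x)) * Real.log (∫ y, F y ∂(κ t x)) ∂(wilsonMeasure (d := 3) (L := L) (fundamentalRep (Fin 2)) β')) -
        (∫ x, (∫ y, F y ∂(κ t x)) ∂(wilsonMeasure (d := 3) (L := L) (fundamentalRep (Fin 2)) β')) *
          Real.log (∫ x, (∫ y, F y ∂(κ t x)) ∂(wilsonMeasure (d := 3) (L := L) (fundamentalRep (Fin 2)) β')) ≤
      Real.exp (-4 * ρ * t) *
        ((∫ x, F x * Real.log (F x) ∂(wilsonMeasure (d := 3) (L := L) (fundamentalRep (Fin 2)) β')) -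
          (∫ x, F x ∂(wilsonMeasure (d := 3) (L := L) (fundamentalRep (Fin 2)) β')) *
            Real.log (∫ x, F x ∂(wilsonMeasure (d := 3) (L := L) (fundamentalRep (Fin 2)) β'))) := by
  intro F
  classical
  haveI := secondCountableTopology_su2
  haveI := borelSpace_config L
  set μ : Measure (GaugeConfig 3 L (Matrix.specialUnitaryGroup (Fin 2) ℂ)) :=
    wilsonMeasure (d := 3) (L := L) (fundamentalRep (Fin 2)) β' with hμ
  haveI : IsProbabilityMeasure μ :=
    isProbabilityMeasure_wilsonMeasure (d := 3) (L := L) (fundamentalRep (Fin 2)) (continuous_fundamentalRep (Fin 2)) β'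
  have hFc : Continuous F := hf.continuous.comp (continuous_coords (L := L))
  obtain ⟨δ, hδ, hδF⟩ := exists_pos_le_of_continuous_of_compactSpace hFc hpos
  obtain ⟨MF, -, hMF⟩ := exists_abs_le_of_continuous hFc
  -- `u s = κ_s F`
  set u : ℝ≥0 → GaugeConfig 3 L (Matrix.specialUnitaryGroup (Fin 2) ℂ) → ℝ := fun s x => ∫ y, F y ∂(κ s x) with hu
  have huc : ∀ s, Continuous (u s) := fun s => continuous_integral_transitionKernel L β' κ hreal s hFc
  have huδ : ∀ s x, δ ≤ u s x := by
    intro s x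
    have := integral_mono (integrable_const (μ := κ s x) δ) (integrable_of_continuous_of_compactSpace hFc _) fun y => hδF y
    rwa [integral_const, probReal_univ, one_smul] at this
  have hupos : ∀ s x, 0 < u s x := fun s x => lt_of_lt_of_le hδ (huδ s x)
  have huM : ∀ s x, |u s x| ≤ MF := fun s x => abs_integral_le_of_abs_le_of_isProbabilityMeasure (μ := κ s x) hMF
  -- invariance: the mass is constant
  have hmass : ∀ s, ∫ x, u s x ∂μ = ∫ x, F x ∂μ := fun s =>
    integral_transitionKernel_integral_eq_wilson (L := L) β' κ hreal s hFc.measurable ⟨MF, hMF⟩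
  -- Chapman–Kolmogorov and the Dynkin Lipschitz bound
  have hCK : ∀ (s h : ℝ≥0) x, ∫ y, u s y ∂(κ h x) = u (s + h) x := fun s h x =>
    transition_transition_cylinder_eq L β' κ hreal hFc s h x
  obtain ⟨C, hC0, hLip⟩ := exists_abs_transition_cylinder_sub_le L β' κ hreal hf hfc
  have hLip' : ∀ (s h : ℝ≥0) x, |u (s + h) x - u s x| ≤ C * h := fun s h x => hLip s h x
  -- the entropy along the flow, as a function of real time
  set m : ℝ := ∫ x, F x ∂μ with hm
  set φ : ℝ → ℝ := fun s => (∫ x, u s.toNNReal x * Real.log (u s.toNNReal x) ∂μ) - m * Real.log m with hφ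
  have hφs : ∀ s : ℝ≥0, φ s = (∫ x, u s x * Real.log (u s x) ∂μ) - (∫ x, u s x ∂μ) * Real.log (∫ x, u s x ∂μ) := by
    intro s; simp only [hφ, Real.toNNReal_coe, hmass]
  -- (a) `φ ≥ 0`
  have hulog : ∀ s, Continuous fun x => u s x * Real.log (u s x) := fun s =>
    (huc s).mul ((huc s).log fun x => (hupos s x).ne')
  have hφ0 : ∀ s : ℝ, 0 ≤ s → 0 ≤ φ s := by
    intro s _
    have h := entropy_nonneg μ (fun x => (hupos s.toNNReal x).le) (integrable_of_continuous_of_compactSpace (huc _) _)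
      (integrable_of_continuous_of_compactSpace (hulog _) _)
    rw [hmass] at h
    exact h
  -- (b) `φ` is continuous: `s ↦ u_s` is continuous into `C(X)` (tube lemma on the joint continuity of the kernel action)
  have hφc : Continuous φ := by
    have hjc : Continuous (Function.uncurry fun (s : ℝ) (x : GaugeConfig 3 L (Matrix.specialUnitaryGroup (Fin 2) ℂ)) =>
        u s.toNNReal x) :=
      (continuous_transitionKernel_action β' κ hreal hFc).comp
        ((continuous_real_toNNReal.comp continuous_fst).prodMk continuous_snd)
    refine Continuous.sub ?_ continuous_const
    refine continuous_iff_continuousAt.2 fun s₀ => ?_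
    have hU := tendstoUniformly_of_continuous_uncurry hjc s₀
    exact EntropyFlow.tendsto_integral_comp_of_tendstoUniformly (ν := μ) (l := 𝓝 s₀)
      (w := fun (s : ℝ) (x : GaugeConfig 3 L (Matrix.specialUnitaryGroup (Fin 2) ℂ)) => u s.toNNReal x)
      (fun s => (huc _).aestronglyMeasurable) (huc _).aestronglyMeasurable (R := MF)
      (fun s x => huM _ x) (fun x => huM _ x) hU Real.continuous_mul_log
  -- (c) the Dini estimate: for `s ≥ 0` and `r > −4ρ φ(s)`, eventually `slope φ s z < r` as `z ↓ s`
  have hD : ∀ s : ℝ, 0 ≤ s → ∀ r : ℝ, -(4 * ρ) * φ s < r → ∃ᶠ z in 𝓝[>] s, slope φ s z < r := by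
    intro s hs r hr
    have hEs : (∫ x, u s.toNNReal x * Real.log (u s.toNNReal x) ∂μ) -
        (∫ x, u s.toNNReal x ∂μ) * Real.log (∫ x, u s.toNNReal x ∂μ) = φ s := by
      have := hφs s.toNNReal
      rw [Real.coe_toNNReal _ hs] at this
      exact this.symm
    have hr' : -(4 * ρ) * ((∫ x, u s.toNNReal x * Real.log (u s.toNNReal x) ∂μ) -
        (∫ x, u s.toNNReal x ∂μ) * Real.log (∫ x, u s.toNNReal x ∂μ)) < r := by rwa [hEs]
    have hCs : ∀ (h : ℝ≥0) x, |(∫ y, u s.toNNReal y ∂(κ h x)) - u s.toNNReal x| ≤ C * h := by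
      intro h x; rw [hCK]; exact hLip' _ _ x
    obtain ⟨hstar, hhstar, hwin⟩ := entropy_transition_sub_lt_of_generatorLogSobolev L β' κ hreal hLSgen (huc _) hδ
      (huδ _) hCs hr'
    have hev : ∀ᶠ z in 𝓝[>] s, slope φ s z < r := by
      filter_upwards [Ioo_mem_nhdsGT (show s < s + hstar by linarith)] with z hz
      obtain ⟨hzs, hzs'⟩ := hz
      have hh0 : 0 < z - s := by linarith
      have hhlt : z - s < hstar := by linarith
      have hhpos' : 0 < (z - s).toNNReal := Real.toNNReal_pos.2 hh0
      have hcoe : (((z - s).toNNReal : ℝ≥0) : ℝ) = z - s := Real.coe_toNNReal _ hh0.le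
      have ez : z.toNNReal = s.toNNReal + (z - s).toNNReal := by
        rw [← Real.toNNReal_add hs hh0.le]; congr 1; ring
      have hw := hwin (z - s).toNNReal hhpos' (by rw [hcoe]; exact hhlt)
      -- identify `κ_h u_s = u_z` and the entropies with `φ z`, `φ s`
      simp_rw [hCK] at hw
      rw [← ez, ← hμ] at hw
      have eφz : (∫ x, u z.toNNReal x * Real.log (u z.toNNReal x) ∂μ) -
          (∫ x, u z.toNNReal x ∂μ) * Real.log (∫ x, u z.toNNReal x ∂μ) = φ z := by
        rw [hφ]; simp only [hmass]
      rw [eφz, hEs, hcoe] at hw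
      rw [slope_def_field, div_lt_iff₀ hh0]
      linarith
    exact hev.frequently
  have hdecay := EntropyFlow.le_mul_exp_neg_mul_of_slope (c := 4 * ρ) (by positivity) hφc.continuousOn hφ0 hD t t.2
  have e0 : φ 0 = (∫ x, F x * Real.log (F x) ∂μ) - m * Real.log m := by
    rw [hφ]
    simp only [Real.toNNReal_zero, hu, transitionKernel_zero_eq_id L β' κ hreal, Kernel.id_apply, integral_dirac]
  rw [hφs t, e0] at hdecay
  calc _ ≤ _ := hdecay
    _ = _ := by ring_nf

end Summit.QuantumFields.YangMills.Theorems.ColdStartUniversality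

end
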